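import Summits.CriticalPhenomena.PercolationContinuityZ3.Theorems.SoloBlindKNQuestion7

/-!
# Kozma–Nitzan's inequality (41) holds at every target no better connected to `b` than the source

[KozmaNitzan2024] = G. Kozma, S. Nitzan, *A reduction of the `θ(p_c) = 0` problem to a conjectured
inequality*, arXiv:2401.12397: Conjecture 2 (p. 3, the "pre-FKG conjecture"
`P(0 ↔ b) ≥ min_{a ∈ A} P(0 ↔ A, a ↔ b)`), its single-target form (41) (p. 36)
`P(0 ↔ b, 0 ↔ A) ≥ P(0 ↔ A, a ↔ b)`, and Questions 7–9 (p. 36: at WHICH targets `a` does (41) hold?).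

## What is proved here (finite graphs, arbitrary edge weights)

Provenance: the computation below is Kozma–Nitzan's own Theorem-1 pairing (pp. 7–8: condition on
`{a₁ ↮ a₂}`, BHK Thm. 1.3 inside `C_{a₂}`, Thm. 1.4 across `C_{a₂}`, `C_{a₁}`; in the tree as
`KNPreFKG.preFKG_pair`) with the roles of SOURCE and TARGET exchanged — `(a₂, {0}, a₁) ↦ (o, A, c)` —
and the event `{a₂ ↔ 0}` generalised to the `C_o`-increasing event `{o ↔ A}`; Question 7 for `|A| = 2`
is the instance `(o, A, c) := (a₂, {0}, a₁)`.  What the paper does not record is the resulting b-side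
regime, uniform in `|A|`, stated in `preFKG41_of_target_le_source` below.


For a finite vertex type `V`, weights `w : Sym2 V → [0,1]`, `μ = prodBernoulli w`, a source `o`, a
target set `A`, and vertices `b, c` (the candidate target `c` need not lie in `A`), write
`D = {o ↮ c}`.

* `real_notConn_mul_sub_le` — the quantitative form
  `μ(D ∩ {o ↔ A}) · (μ(D ∩ {o ↔ b}) − μ(D ∩ {c ↔ b})) ≤ μ(D) · (μ(D ∩ {o ↔ A, o ↔ b}) − μ(D ∩ {o ↔ A, c ↔ b}))`,
  i.e. `P(o ↔ b, o ↔ A | D) − P(o ↔ A, c ↔ b | D) ≥ P(o ↔ A | D) · (P(o ↔ b | D) − P(c ↔ b | D))`.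
  Proof: condition on `D = {o ↮ c}`; `{o ↔ A}` and `{o ↔ b}` are increasing events read on the open
  edge cluster `C_o`, `{c ↔ b}` is increasing and read on `C_c`; the van den Berg–Häggström–Kahn
  inequalities give positive correlation of the first two (BHK 2006 Thm. 1.3, the tree's
  `KNPreFKG.bhk_one_upper_upper`) and negative correlation of `{o ↔ A}` with `{c ↔ b}` (BHK 2006
  Thm. 1.4, `KNPreFKG.bhk_two_upper_upper`) given `D`.
* `real_sdiff_notConn_eq`, `real_inter_sdiff_notConn_eq` — off `D` (i.e. on `{o ↔ c}`) the events
  `{o ↔ b}` and `{c ↔ b}` coincide, so `μ(D ∩ {o ↔ b}) − μ(D ∩ {c ↔ b}) = μ{o ↔ b} − μ{c ↔ b}` and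
  likewise with `{o ↔ A}` intersected.
* `preFKG41_of_target_le_source` — **(41) holds at `(G, A, o, b)` for every target `c` with
  `P(c ↔ b) ≤ P(o ↔ b)`**: `μ({c ↔ b} ∩ {o ↔ A}) ≤ μ({o ↔ b} ∩ {o ↔ A})`.  Consequently
  (`knQuestion7_at_of_exists_le_source`, `knConj2_at_of_exists_le_source`) Kozma–Nitzan's Question 7
  and Conjecture 2 hold at every `(G, A, o, b)` with `min_{a ∈ A} P(a ↔ b) ≤ P(o ↔ b)`: a counterexample
  to Question 7, to Conjecture 2 or to (41) at the `P(· ↔ b)`-minimiser must have EVERY point of `A`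
  strictly better connected to `b` than the source `o` is.  (For the post-FKG Conjecture 1 this regime
  is trivial — `P(0 ↔ A) min_a P(a ↔ b) ≤ P(0 ↔ b)` outright — but (41) is not implied by FKG there:
  `P(0 ↔ A, c ↔ b)` may exceed `P(0 ↔ A) P(c ↔ b)`.)

This complements the printed proved cases (Theorem 1: `|A| = 2`; Theorem 2: `|A| = 3` with
`m_j ≤ m_{A∖j}` for some `j`; Theorem 3: `|A| = 3`, `A` separating `0` from `b`; Theorems 4–5: `0`
close to `A`) by a regime defined on the `b`-side.  Elementary given BHK; no sorry, no new axioms.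
It is irrelevant to Conjecture 3 / Theorem 6 (there the hypothesis `P(0 ↔ b) ≥ min_a P(a ↔ b) > 1 - δ`
would already be the conclusion): a frontier remark on Questions 7–9, not a step towards `θ(p_c) = 0`.
[cite: KozmaNitzan2024, Conjecture 2 (p. 3), (41) and Questions 7–9 (p. 36);
VandenbergHaggstromKahn2005, Thms. 1.3–1.4]
-/

noncomputable section

open MeasureTheory Set Finset
open scoped BigOperators
open Literature.Probability.LatticeModels (prodBernoulli)
open Literature.Probability.Percolation
open Literature.Probability.Percolation.KNPreFKG

namespace Summit.CriticalPhenomena.PercolationContinuityZ3.Theorems.SoloBlindKN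

section TargetBelowSource

variable {V : Type*} [Fintype V]

/-- The family of edge sets from which some vertex of `A` is seen from `o`; `{o ↔ A}` is the event
that the open edge cluster `C_o` lies in it (`connTo_eq_setOf_connToFamily`). -/
def connToFamily (o : V) (A : Finset V) : Set (Set (Sym2 V)) := {C | ∃ a ∈ A, C ∈ connFamily o a}

omit [Fintype V] in
/-- `connToFamily o A` is an upper family (a union of the upper families `connFamily o a`). -/
theorem isUpperSet_connToFamily (o : V) (A : Finset V) : IsUpperSet (connToFamily o A) := by
  intro C C' hCC' hC
  obtain ⟨a, ha, hCa⟩ := hC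
  exact ⟨a, ha, isUpperSet_connFamily o a hCC' hCa⟩

omit [Fintype V] in
/-- `{o ↔ A} = {ω | C_o(ω) ∈ connToFamily o A}`. -/
theorem connTo_eq_setOf_connToFamily (o : V) (A : Finset V) :
    connTo o A = {ω : BondConfig V | openEdgeCluster ω o ∈ connToFamily o A} := by
  ext ω
  have key : ∀ a : V, ω ∈ openConn o a ↔ openEdgeCluster ω o ∈ connFamily o a := fun a => by
    rw [openConn_eq_setOf_connFamily o a]; exact Iff.rfl
  simp only [connTo, Set.mem_iUnion, Set.mem_setOf_eq, connToFamily, exists_prop, key]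

omit [Fintype V] in
/-- On `{o ↔ c}` the events `{o ↔ b}` and `{c ↔ b}` coincide. -/
theorem sdiff_notConn_eq (o b c : V) :
    openConn o b \ {ω : BondConfig V | ¬ (openGraph ω).Reachable o c} =
      openConn c b \ {ω : BondConfig V | ¬ (openGraph ω).Reachable o c} := by
  ext ω
  simp only [Set.mem_sdiff, Set.mem_setOf_eq, not_not, openConn]
  constructor
  · rintro ⟨hob, hoc⟩
    exact ⟨hoc.symm.trans hob, hoc⟩
  · rintro ⟨hcb, hoc⟩
    exact ⟨hoc.trans hcb, hoc⟩

omit [Fintype V] in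
/-- On `{o ↔ c}` the events `{o ↔ A, o ↔ b}` and `{o ↔ A, c ↔ b}` coincide. -/
theorem inter_sdiff_notConn_eq (A : Finset V) (o b c : V) :
    (connTo o A ∩ openConn o b) \ {ω : BondConfig V | ¬ (openGraph ω).Reachable o c} =
      (connTo o A ∩ openConn c b) \ {ω : BondConfig V | ¬ (openGraph ω).Reachable o c} := by
  rw [Set.inter_sdiff_assoc, Set.inter_sdiff_assoc, sdiff_notConn_eq]

/-- **The quantitative form.**  With `D = {o ↮ c}`:
`μ(D ∩ {o ↔ A}) · (μ(D ∩ {o ↔ b}) − μ(D ∩ {c ↔ b})) ≤ μ(D) · (μ(D ∩ {o ↔ A} ∩ {o ↔ b}) − μ(D ∩ {o ↔ A} ∩ {c ↔ b}))`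
— BHK Thm. 1.3 (positive correlation of `{o ↔ A}`, `{o ↔ b}` on `C_o` given `D`) and Thm. 1.4
(negative correlation of `{o ↔ A}` on `C_o` with `{c ↔ b}` on `C_c` given `D`).
[cite: VandenbergHaggstromKahn2005, Thms. 1.3–1.4; KozmaNitzan2024, (41) p. 36] -/
theorem real_notConn_mul_sub_le (w : Sym2 V → unitInterval) (A : Finset V) (o b c : V)
    (hoc : o ≠ c) :
    (prodBernoulli w).real ({ω : BondConfig V | ¬ (openGraph ω).Reachable o c} ∩ connTo o A) *
        ((prodBernoulli w).real ({ω : BondConfig V | ¬ (openGraph ω).Reachable o c} ∩ openConn o b) -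
          (prodBernoulli w).real
            ({ω : BondConfig V | ¬ (openGraph ω).Reachable o c} ∩ openConn c b)) ≤
      (prodBernoulli w).real {ω : BondConfig V | ¬ (openGraph ω).Reachable o c} *
        ((prodBernoulli w).real
            ({ω : BondConfig V | ¬ (openGraph ω).Reachable o c} ∩ (connTo o A ∩ openConn o b)) -
          (prodBernoulli w).real
            ({ω : BondConfig V | ¬ (openGraph ω).Reachable o c} ∩ (connTo o A ∩ openConn c b))) := by
  have hD : {ω : BondConfig V | ∀ x ∈ ({c} : Set V), ¬ (openGraph ω).Reachable o x} =
      {ω : BondConfig V | ¬ (openGraph ω).Reachable o c} := by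
    ext ω
    simp
  have hnot : o ∉ ({c} : Set V) := by simpa using hoc
  have h13 := bhk_one_upper_upper w o ({c} : Set V) hnot (isUpperSet_connToFamily o A)
    (isUpperSet_connFamily o b)
  have h14 := bhk_two_upper_upper w o c hoc (isUpperSet_connToFamily o A)
    (isUpperSet_connFamily c b)
  rw [hD, ← connTo_eq_setOf_connToFamily, ← openConn_eq_setOf_connFamily] at h13
  rw [← connTo_eq_setOf_connToFamily, ← openConn_eq_setOf_connFamily] at h14
  rw [mul_sub, mul_sub]
  linarith

/-- `μ(D ∩ {o ↔ b}) − μ(D ∩ {c ↔ b}) = μ{o ↔ b} − μ{c ↔ b}` for `D = {o ↮ c}`. -/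
theorem real_sdiff_notConn_eq (w : Sym2 V → unitInterval) (o b c : V) :
    (prodBernoulli w).real ({ω : BondConfig V | ¬ (openGraph ω).Reachable o c} ∩ openConn o b) -
        (prodBernoulli w).real ({ω : BondConfig V | ¬ (openGraph ω).Reachable o c} ∩ openConn c b) =
      (prodBernoulli w).real (openConn o b) - (prodBernoulli w).real (openConn c b) := by
  classical
  have hDm : MeasurableSet {ω : BondConfig V | ¬ (openGraph ω).Reachable o c} :=
    MeasurableSet.of_discrete
  have e1 := measureReal_inter_add_sdiff (μ := prodBernoulli w) (s := openConn o b) hDm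
  have e2 := measureReal_inter_add_sdiff (μ := prodBernoulli w) (s := openConn c b) hDm
  rw [sdiff_notConn_eq] at e1
  rw [Set.inter_comm _ (openConn o b), Set.inter_comm _ (openConn c b)]
  linarith

/-- `μ(D ∩ {o ↔ A} ∩ {o ↔ b}) − μ(D ∩ {o ↔ A} ∩ {c ↔ b}) = μ({o ↔ A} ∩ {o ↔ b}) − μ({o ↔ A} ∩ {c ↔ b})`. -/
theorem real_inter_sdiff_notConn_eq (w : Sym2 V → unitInterval) (A : Finset V) (o b c : V) :
    (prodBernoulli w).real
          ({ω : BondConfig V | ¬ (openGraph ω).Reachable o c} ∩ (connTo o A ∩ openConn o b)) -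
        (prodBernoulli w).real
          ({ω : BondConfig V | ¬ (openGraph ω).Reachable o c} ∩ (connTo o A ∩ openConn c b)) =
      (prodBernoulli w).real (connTo o A ∩ openConn o b) -
        (prodBernoulli w).real (connTo o A ∩ openConn c b) := by
  classical
  have hDm : MeasurableSet {ω : BondConfig V | ¬ (openGraph ω).Reachable o c} :=
    MeasurableSet.of_discrete
  have e1 := measureReal_inter_add_sdiff (μ := prodBernoulli w) (s := connTo o A ∩ openConn o b) hDm
  have e2 := measureReal_inter_add_sdiff (μ := prodBernoulli w) (s := connTo o A ∩ openConn c b) hDm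
  rw [inter_sdiff_notConn_eq] at e1
  rw [Set.inter_comm _ (connTo o A ∩ openConn o b), Set.inter_comm _ (connTo o A ∩ openConn c b)]
  linarith

/-- **(41) at every target no better connected to `b` than the source.**  If `P(c ↔ b) ≤ P(o ↔ b)`
then `P(o ↔ A, c ↔ b) ≤ P(o ↔ b, o ↔ A)` — for every finite weighted graph, every `A`, and every `c`
(in `A` or not).  [cite: KozmaNitzan2024, (41) p. 36 (new proved case)] -/
theorem preFKG41_of_target_le_source (w : Sym2 V → unitInterval) (A : Finset V) (o b c : V)
    (h : (prodBernoulli w).real (openConn c b) ≤ (prodBernoulli w).real (openConn o b)) :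
    (prodBernoulli w).real (openConn c b ∩ connTo o A) ≤
      (prodBernoulli w).real (openConn o b ∩ connTo o A) := by
  classical
  by_cases hoc : o = c
  · subst hoc
    exact le_rfl
  set D : Set (BondConfig V) := {ω : BondConfig V | ¬ (openGraph ω).Reachable o c} with hDdef
  have main := real_notConn_mul_sub_le w A o b c hoc
  have eb := real_sdiff_notConn_eq w o b c
  have eA := real_inter_sdiff_notConn_eq w A o b c
  rw [← hDdef] at main eb eA
  rw [Set.inter_comm (openConn c b), Set.inter_comm (openConn o b)]
  -- it suffices to compare the `D`-parts, which differ from the full events by the same amount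
  have hsub : 0 ≤ (prodBernoulli w).real (D ∩ openConn o b) -
      (prodBernoulli w).real (D ∩ openConn c b) := by
    rw [eb]; linarith
  have hprod : 0 ≤ (prodBernoulli w).real D *
      ((prodBernoulli w).real (D ∩ (connTo o A ∩ openConn o b)) -
        (prodBernoulli w).real (D ∩ (connTo o A ∩ openConn c b))) :=
    le_trans (mul_nonneg measureReal_nonneg hsub) main
  rcases (measureReal_nonneg (μ := prodBernoulli w) (s := D)).eq_or_lt with hD0 | hDpos
  · -- μ(D) = 0: the `D`-part of the right-hand side event is null
    have hnull : (prodBernoulli w).real (D ∩ (connTo o A ∩ openConn c b)) = 0 :=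
      measureReal_mono_null Set.inter_subset_left hD0.symm
    have hnn : 0 ≤ (prodBernoulli w).real (D ∩ (connTo o A ∩ openConn o b)) := measureReal_nonneg
    linarith
  · have := (mul_nonneg_iff_of_pos_left hDpos).mp hprod
    linarith

/-- **Question 7 at `(G, A, o)` holds at every `b` with `min_{a ∈ A} P(a ↔ b) ≤ P(o ↔ b)`** (for every
`P(· ↔ b)`-minimiser `a`). [cite: KozmaNitzan2024, Question 7 (p. 36)] -/
theorem knQuestion7_at_of_exists_le_source (w : Sym2 V → unitInterval) (A : Finset V) (o b : V)
    (hb : ∃ a' ∈ A, (prodBernoulli w).real (openConn a' b) ≤ (prodBernoulli w).real (openConn o b))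
    (a : V) (_ha : a ∈ A)
    (hmin : ∀ a' ∈ A, (prodBernoulli w).real (openConn a b) ≤ (prodBernoulli w).real (openConn a' b)) :
    (prodBernoulli w).real (openConn a b ∩ connTo o A) ≤
      (prodBernoulli w).real (openConn o b ∩ connTo o A) := by
  classical
  obtain ⟨a', ha', hle⟩ := hb
  exact preFKG41_of_target_le_source w A o b a ((hmin a' ha').trans hle)

/-- **Conjecture 2 at `(G, A, o, b)` holds whenever `min_{a ∈ A} P(a ↔ b) ≤ P(o ↔ b)`**:
`∃ a ∈ A, P(o ↔ A, a ↔ b) ≤ P(o ↔ b)`.  Hence any counterexample to Kozma–Nitzan's Conjecture 2 has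
`P(o ↔ b) < min_{a ∈ A} P(a ↔ b)`. [cite: KozmaNitzan2024, Conjecture 2 (p. 3)] -/
theorem knConj2_at_of_exists_le_source (w : Sym2 V → unitInterval) (A : Finset V) (o b : V)
    (hb : ∃ a ∈ A, (prodBernoulli w).real (openConn a b) ≤ (prodBernoulli w).real (openConn o b)) :
    ∃ a ∈ A, (prodBernoulli w).real (openConn a b ∩ connTo o A) ≤
      (prodBernoulli w).real (openConn o b) := by
  classical
  obtain ⟨a, ha, hle⟩ := hb
  exact knConj2_at_of_preFKG w A o b a ha (preFKG41_of_target_le_source w A o b a hle)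

omit [Fintype V] in
/-- `{o ↔ A}` for the pair `A = {a₁, a₂}` is `{o ↔ a₁} ∪ {o ↔ a₂}`. -/
theorem connTo_pair [DecidableEq V] (o a₁ a₂ : V) :
    connTo o ({a₁, a₂} : Finset V) = openConn o a₁ ∪ openConn o a₂ := by
  ext ω
  simp only [connTo, Set.mem_iUnion, exists_prop, Finset.mem_insert, Finset.mem_singleton,
    Set.mem_union]
  constructor
  · rintro ⟨a, rfl | rfl, ha⟩
    · exact Or.inl ha
    · exact Or.inr ha
  · rintro (h | h)
    · exact ⟨a₁, Or.inl rfl, h⟩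
    · exact ⟨a₂, Or.inr rfl, h⟩

omit [Fintype V] in
/-- `{o ↔ A}` for the singleton `A = {a}` is `{o ↔ a}`. -/
theorem connTo_singleton (o a : V) : connTo o ({a} : Finset V) = openConn o a := by
  ext ω
  simp [connTo]

/-- **Question 7 for `|A| = 2` is the instance `(o, A, c) := (a₂, {o}, a₁)` of
`preFKG41_of_target_le_source`** (the provenance remark of the module docstring, in Lean): if
`P(a₁ ↔ b) ≤ P(a₂ ↔ b)` then (41) holds at `a₁` for `A = {a₁, a₂}`:
`P(o ↔ A, a₁ ↔ b) ≤ P(o ↔ b, o ↔ A)`.  Proof: on `{o ↔ a₂}ᶜ` both events equal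
`{o ↔ a₁, a₁ ↔ b, o ↮ a₂}`; on `{o ↔ a₂}` they are `{a₂ ↔ o, a₁ ↔ b}` and `{a₂ ↔ b, a₂ ↔ o}`, compared by
the source/target-exchanged lemma.  (Kozma–Nitzan's Theorem 1 is the consequence `∃ a ∈ A, …`; the
tree's `KNPreFKG.preFKG_pair` proves that form directly.)
[cite: KozmaNitzan2024, Thm. 1 (pp. 7–8), Question 7 (p. 36)] -/
theorem preFKG41_pair_at_argmin [DecidableEq V] (w : Sym2 V → unitInterval) (o b a₁ a₂ : V)
    (h : (prodBernoulli w).real (openConn a₁ b) ≤ (prodBernoulli w).real (openConn a₂ b)) :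
    (prodBernoulli w).real (openConn a₁ b ∩ connTo o ({a₁, a₂} : Finset V)) ≤
      (prodBernoulli w).real (openConn o b ∩ connTo o ({a₁, a₂} : Finset V)) := by
  classical
  -- the exchanged instance: source `a₂`, target set `{o}`, candidate target `a₁`
  have hx := preFKG41_of_target_le_source w ({o} : Finset V) a₂ b a₁ h
  rw [connTo_singleton] at hx
  -- `{a₂ ↔ b} ∩ {a₂ ↔ o} = {o ↔ b} ∩ {o ↔ a₂}` and `{a₁ ↔ b} ∩ {a₂ ↔ o} = {a₁ ↔ b} ∩ {o ↔ a₂}`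
  have e1 : openConn a₂ b ∩ openConn a₂ o = (openConn o b ∩ openConn o a₂ : Set (BondConfig V)) := by
    ext ω
    simp only [Set.mem_inter_iff, openConn, Set.mem_setOf_eq]
    constructor
    · rintro ⟨h2b, h2o⟩
      exact ⟨h2o.symm.trans h2b, h2o.symm⟩
    · rintro ⟨hob, ho2⟩
      exact ⟨ho2.symm.trans hob, ho2.symm⟩
  have e2 : openConn a₁ b ∩ openConn a₂ o = (openConn a₁ b ∩ openConn o a₂ : Set (BondConfig V)) := by
    rw [openConn_symm a₂ o]
  rw [e1, e2] at hx
  -- split both sides of the goal along `T = {o ↔ a₂}`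
  have hTm : MeasurableSet (openConn o a₂ : Set (BondConfig V)) := MeasurableSet.of_discrete
  have s1 := measureReal_inter_add_sdiff (μ := prodBernoulli w)
    (s := openConn a₁ b ∩ connTo o ({a₁, a₂} : Finset V)) hTm
  have s2 := measureReal_inter_add_sdiff (μ := prodBernoulli w)
    (s := openConn o b ∩ connTo o ({a₁, a₂} : Finset V)) hTm
  have i1 : openConn a₁ b ∩ connTo o ({a₁, a₂} : Finset V) ∩ openConn o a₂ =
      (openConn a₁ b ∩ openConn o a₂ : Set (BondConfig V)) := by
    rw [connTo_pair, Set.inter_assoc, Set.union_inter_cancel_right]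
  have i2 : openConn o b ∩ connTo o ({a₁, a₂} : Finset V) ∩ openConn o a₂ =
      (openConn o b ∩ openConn o a₂ : Set (BondConfig V)) := by
    rw [connTo_pair, Set.inter_assoc, Set.union_inter_cancel_right]
  have d12 : (openConn a₁ b ∩ connTo o ({a₁, a₂} : Finset V)) \ openConn o a₂ =
      ((openConn o b ∩ connTo o ({a₁, a₂} : Finset V)) \ openConn o a₂ : Set (BondConfig V)) := by
    ext ω
    simp only [connTo_pair, Set.mem_sdiff, Set.mem_inter_iff, Set.mem_union, openConn,
      Set.mem_setOf_eq]
    constructor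
    · rintro ⟨⟨h1b, h1 | h2⟩, hn2⟩
      · exact ⟨⟨h1.trans h1b, Or.inl h1⟩, hn2⟩
      · exact absurd h2 hn2
    · rintro ⟨⟨hob, h1 | h2⟩, hn2⟩
      · exact ⟨⟨h1.symm.trans hob, Or.inl h1⟩, hn2⟩
      · exact absurd h2 hn2
  rw [i1] at s1
  rw [i2] at s2
  rw [d12] at s1
  linarith

/-- **Question 7 holds for `|A| = 2`**, in the `KNQuestion7`-shape: for `A = {a₁, a₂}` and every
`P(· ↔ b)`-minimiser `a ∈ A`, (41) holds at `a`. [cite: KozmaNitzan2024, Question 7 (p. 36), Thm. 1 (p. 7)] -/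
theorem knQuestion7_at_pair [DecidableEq V] (w : Sym2 V → unitInterval) (o b a₁ a₂ : V)
    (a : V) (ha : a ∈ ({a₁, a₂} : Finset V))
    (hmin : ∀ a' ∈ ({a₁, a₂} : Finset V),
      (prodBernoulli w).real (openConn a b) ≤ (prodBernoulli w).real (openConn a' b)) :
    (prodBernoulli w).real (openConn a b ∩ connTo o ({a₁, a₂} : Finset V)) ≤
      (prodBernoulli w).real (openConn o b ∩ connTo o ({a₁, a₂} : Finset V)) := by
  classical
  simp only [Finset.mem_insert, Finset.mem_singleton] at ha
  rcases ha with rfl | rfl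
  · exact preFKG41_pair_at_argmin w o b a a₂ (hmin a₂ (by simp))
  · have h' := preFKG41_pair_at_argmin w o b a a₁ (hmin a₁ (by simp))
    rwa [Finset.pair_comm] at h'

end TargetBelowSource

end Summit.CriticalPhenomena.PercolationContinuityZ3.Theorems.SoloBlindKN
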